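import Literature.NumberTheory.EllipticCurves.KubertTateFiveMuDescentGaussianMatrix
import Literature.NumberTheory.EllipticCurves.KubertTate133GaussianValuations
import Literature.NumberTheory.EllipticCurves.KubertTate133ShaFive
import Literature.NumberTheory.EllipticCurves.KubertTateFiveGaussianTwistRankZero
import Mathlib.Tactic.NormNum.Prime
import HarnessLib

/-!
# The `5`-descent of `E_{13/3}` over `ℚ(i)` (inert `3`, split `13`, a twist point with denominators):
# `rank E_{13/3}(ℚ(i)) = 2`, `Ш[5^∞] = 0`; the twist `E_{13/3}^{(-4)}/ℚ` has RANK `1` and `t₅ = 0`, by descent alone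

PROOF-ONLY file (theorems only, no definition, no named fact, no `sorry`), topic `NumberTheory/EllipticCurves`;
the second INSTANCE of the matrix form of the `5`-isogeny descent of the Kubert–Tate family over the Gaussian field
(`KubertTateFiveMuDescentGaussianMatrix`), at `(m, n) = (13, 3)` — the generic shape: an INERT place, a split pair,
and a twist point with denominators:

  `E = E_{13/3} = [-10, -39, -117, 0, 0]`, `Δ = -3⁵·13⁵·269`, `rank E(ℚ) = 1`, `t₅(E) = 0` (tree `KubertTate133Descent`);
  `mn = 39 = 3·13`, places `v₀ = (3)`, `v₁ = (2 + 3ζ)`, `v₂ = (2 − 3ζ)` of `ℚ(i)`.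

The box of THREE places is filled by `−T = (0, 117)`, `(105, 1617)` and the `ℚ(i)`-point `Q = (-65/4, -91/4 + (949/8)ζ)` (the
point `(u, Y) = (-65/4, 949/4)` of the twist `Y² = -(4u³ + b₂u² + 2b₄u + b₆)`), whose Kummer value is `(−20072 − 27521ζ)/32`
(`32` a unit at the three places); the `3 × 3` matrix of orders relative to `f_T(2T) = 19773`,
`M = [[3,2,2],[0,3,3],[2,2,4]]` (mod `5`, `log`-normalised), is invertible (inverse `[[2,2,0],[2,1,2],[3,1,3]]`). Hence:

* `shaCorank_five_eq_zero` — **`t₅(E_{13/3} ⊗ ℚ(i)) = 0`**; `sha_torsionBy_five_eq_bot`; `mordellWeilRank_eq_two` —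
  **`rank E_{13/3}(ℚ(i)) = 2`**;
* `mordellWeilRank_twist_eq_one` — **`rank E_{13/3}^{(-4)}(ℚ) = 1`**; `shaCorank_five_twist_eq_zero` —
  **`t₅(E_{13/3}^{(-4)}/ℚ) = 0`** — a rank-`1` curve without rational `5`-torsion, by descent alone (no `L`-value, no
  Gross–Zagier–Kolyvagin).

Transfer statement T (stmt-22356) instrument; BSD is not proved by this.

## References

* [SilvermanAEC2009] J. H. Silverman, *AEC*, 2nd ed., Thm. X.4.2, Prop. X.4.9, Exercise 10.1(c), Exercise 10.16, VII.3.1(b).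
* [Fisher2001FiveSevenDescent] T. Fisher, JEMS 3 (2001), §§1–2.
* [IrelandRosen1982] K. Ireland, M. Rosen, *A Classical Introduction to Modern Number Theory*, Ch. 9 §7 Lemmas 4–5.
* [Dokchitser2013ParityNotes] T. Dokchitser, Notes on the parity conjecture (2013), §4.
-/

noncomputable section

open scoped Classical NNReal NumberField AddSubgroup
open WeierstrassCurve WeierstrassCurve.Isogeny Field IsDedekindDomain Ideal
open Literature.NumberTheory.EllipticCurves Literature.NumberTheory.EllipticCurves.KubertTateVelu
  Literature.NumberTheory.EllipticCurves.KubertTateMuDescentNF Literature.NumberTheory.NumberFields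

namespace Literature.NumberTheory.EllipticCurves

namespace KubertTate133GaussianDescent

variable {K : Type} [Field K] [NumberField K] [IsCyclotomicExtension {4} ℚ K]

/-! ## §1 The curve and the points over `ℚ(i)` -/

omit [IsCyclotomicExtension {4} ℚ K] in
/-- `E_{13/3} ⊗ K` is elliptic. [cite: Kubert1976, Table 3 (N = 5)] -/
theorem isElliptic : (kubertTateFive ((13 : ℤ) : K) ((3 : ℤ) : K)).IsElliptic :=
  haveI := KubertTate133Descent.isElliptic
  KubertTateGaussianTwist.isElliptic_base (K := K) 13 3

omit [IsCyclotomicExtension {4} ℚ K] in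
/-- `−T = (0, 117)`, `(105, 1617)`, the twist point `(-65/4, -91/4 + (949/8)ζ)` (for `ζ² = -1`) and the base point
`2T = (39, 507)` lie on `E_{13/3} ⊗ K`. [cite: Fisher2001FiveSevenDescent, §2 (the family; these points verified in-file)] -/
theorem nonsingular_points {ζ : K} (hζ : ζ ^ 2 + 1 = 0) :
    (kubertTateFive ((13 : ℤ) : K) ((3 : ℤ) : K)).toAffine.Nonsingular 0 117 ∧
    (kubertTateFive ((13 : ℤ) : K) ((3 : ℤ) : K)).toAffine.Nonsingular 105 1617 ∧
    (kubertTateFive ((13 : ℤ) : K) ((3 : ℤ) : K)).toAffine.Nonsingular (-65 / 4) (-91 / 4 + 949 / 8 * ζ) ∧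
    (kubertTateFive ((13 : ℤ) : K) ((3 : ℤ) : K)).toAffine.Nonsingular 39 507 := by
  haveI := isElliptic (K := K)
  refine ⟨?_, ?_, ?_, ?_⟩ <;>
    rw [← Affine.equation_iff_nonsingular, KubertTateMuDescentNF.equation_iff_base (K := K) 13 3] <;> push_cast
  · norm_num
  · norm_num
  · linear_combination (900601 / 64 : K) * hζ
  · norm_num

omit [IsCyclotomicExtension {4} ℚ K] in
/-- `P₁ = (105, 1617) ∈ E(ℚ)` (reference point of the `μ₅`-side). [cite: SilvermanAEC2009, VIII.§1] -/
theorem nonsingular_P₁_rat :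
    (kubertTateFive (((13 : ℤ) : ℚ)) (((3 : ℤ) : ℚ))).toAffine.Nonsingular 105 1617 :=
  (KubertTate133Descent.nonsingular_iff _ _).mpr (by norm_num)

/-! ## §2 Places above different rational primes are distinct -/

omit [NumberField K] [IsCyclotomicExtension {4} ℚ K] in
/-- Places above different rational primes are different. [cite: IrelandRosen1982, Ch. 9 §7] -/
private theorem ne_of_natCast_mem {v w : HeightOneSpectrum (𝓞 K)} {ℓ ℓ' : ℕ} (hℓ : ℓ.Prime) (hℓ' : ℓ'.Prime)
    (hne : ℓ ≠ ℓ') (h : (ℓ : 𝓞 K) ∈ v.asIdeal) (h' : (ℓ' : 𝓞 K) ∈ w.asIdeal) : v ≠ w := by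
  rintro rfl
  have hd := natCast_dvd_of_intCast_mem hℓ h (d := ℓ') (by exact_mod_cast h')
  exact hne ((Nat.prime_dvd_prime_iff_eq hℓ hℓ').mp (by exact_mod_cast hd))

/-! ## §3 The descent over `ℚ(i)`: box full at three places -/

/-- **The complete `5`-descent of `E_{13/3}` over `ℚ(i)`**: `t₅(E ⊗ ℚ(i)) = 0`, `Ш(E ⊗ ℚ(i))[5] = 0` and `rank E(ℚ(i)) + 1 = 3`.
[cite: SilvermanAEC2009, Thm. X.4.2(a) and Thm. X.1.1] [cite: Fisher2001FiveSevenDescent, §2] -/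
theorem descent :
    haveI := isElliptic (K := K)
    (kubertTateFive ((13 : ℤ) : K) ((3 : ℤ) : K)).shaCorank 5 = 0 ∧
      (kubertTateFive ((13 : ℤ) : K) ((3 : ℤ) : K)).sha[((5 : ℕ) : ℤ)] = ⊥ ∧
      (kubertTateFive ((13 : ℤ) : K) ((3 : ℤ) : K)).mordellWeilRank + 1 = 3 := by
  haveI := isElliptic (K := K)
  haveI := KubertTate133Descent.isElliptic
  haveI : Fact (Nat.Prime 2) := ⟨Nat.prime_two⟩
  -- the fourth root of unity and the places
  set ζ : 𝓞 K := (IsCyclotomicExtension.zeta_spec 4 ℚ K).toInteger with hζdef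
  have hζ : IsPrimitiveRoot ζ 4 := (IsCyclotomicExtension.zeta_spec 4 ℚ K).toInteger_isPrimitiveRoot
  have hsq : ζ ^ 2 + 1 = 0 := by
    rw [(hζ.pow (by norm_num) (show 4 = 2 * 2 by norm_num)).eq_neg_one_of_two_right, neg_add_cancel]
  have hsqK : (ζ : K) ^ 2 + 1 = 0 := by
    have := congrArg (fun t : 𝓞 K ↦ (t : K)) hsq
    simpa [NumberField.RingOfIntegers.coe_eq_algebraMap] using this
  obtain ⟨v₀, v₁, v₂, hv₀, hv₁, hv₂⟩ := exists_places hζ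
  obtain ⟨hℓ₀, hℓ₁, hℓ₂⟩ := natCast_mem_places hζ hv₀ hv₁ hv₂
  have hπ₁ : (2 : 𝓞 K) + 3 * ζ ∈ v₁.asIdeal := by rw [hv₁]; exact mem_span_singleton_self _
  have hπ₂ : (2 : 𝓞 K) - 3 * ζ ∈ v₂.asIdeal := by rw [hv₂]; exact mem_span_singleton_self _
  have p₀ : Prime (3 : 𝓞 K) := by
    simpa using prime_natCast_of_mod_four_eq_three (K := K) Nat.prime_three (by norm_num)
  have p₁ : Prime ((2 : 𝓞 K) + 3 * ζ) := by
    simpa using prime_int_add_int_mul_four hζ (a := 2) (b := 3) (ℓ := 13) (by norm_num) (by norm_num)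
  have p₂ : Prime ((2 : 𝓞 K) - 3 * ζ) := by
    have h := prime_int_add_int_mul_four hζ (a := 2) (b := -3) (ℓ := 13) (by norm_num) (by norm_num)
    have e : ((2 : ℤ) : 𝓞 K) + ((-3 : ℤ) : 𝓞 K) * ζ = (2 : 𝓞 K) - 3 * ζ := by push_cast; ring
    rwa [e] at h
  have h3v₀ : (3 : 𝓞 K) ∈ v₀.asIdeal := by exact_mod_cast hℓ₀
  -- distinctness of the three places
  have h01 : v₀ ≠ v₁ := ne_of_natCast_mem Nat.prime_three (by norm_num) (by norm_num) hℓ₀ hℓ₁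
  have h02 : v₀ ≠ v₂ := ne_of_natCast_mem Nat.prime_three (by norm_num) (by norm_num) hℓ₀ hℓ₂
  have h12 : v₁ ≠ v₂ := by
    intro e
    have hmem : (2 : 𝓞 K) - 3 * ζ ∈ span {(2 : 𝓞 K) + 3 * ζ} := by rw [← hv₁, e]; exact hπ₂
    have := int_sub_int_mul_not_mem_span hζ (a := 2) (b := 3) (ℓ := 13) (by norm_num) (by norm_num) (by norm_num)
      (by norm_num)
    exact this (by simpa using hmem)
  have hpl : Function.Injective ![v₀, v₁, v₂] := by
    intro i j h
    fin_cases i <;> fin_cases j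
    · rfl
    · exact absurd h h01
    · exact absurd h h02
    · exact absurd h h01.symm
    · rfl
    · exact absurd h h12
    · exact absurd h h02.symm
    · exact absurd h h12.symm
    · rfl
  -- the support: off the three places, `13` and `3` are units
  have hS : ∀ v : HeightOneSpectrum (𝓞 K), (∀ j, ![v₀, v₁, v₂] j ≠ v) →
      (((13 : ℤ) : ℤ) : 𝓞 K) ∉ v.asIdeal ∧ (((3 : ℤ) : ℤ) : 𝓞 K) ∉ v.asIdeal := by
    intro v hv
    have n0 : v₀ ≠ v := hv 0
    have n1 : v₁ ≠ v := hv 1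
    have n2 : v₂ ≠ v := hv 2
    constructor
    · intro h13mem
      have e : (((13 : ℤ) : ℤ) : 𝓞 K) = ((13 : ℕ) : 𝓞 K) := by push_cast; norm_num
      rw [e] at h13mem
      rcases mem_or_mem_of_sq_add_sq_eq hζ (a := 2) (b := 3) (ℓ := 13) (by norm_num) h13mem with h' | h'
      · exact n1 (eq_of_mem_of_mem_of_prime p₁ hπ₁ (by simpa using h'))
      · exact n2 (eq_of_mem_of_mem_of_prime p₂ hπ₂ (by simpa using h'))
    · intro h3mem
      have e : (((3 : ℤ) : ℤ) : 𝓞 K) = (3 : 𝓞 K) := by push_cast; norm_num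
      rw [e] at h3mem
      exact n0 (eq_of_mem_of_mem_of_prime p₀ h3v₀ h3mem)
  -- the points
  obtain ⟨hn0, hn1, hn2, hnb⟩ := nonsingular_points hsqK
  -- the Kummer values: numerators in `ℤ[i]` over denominators `1, 1, 32`
  have hf : ∀ i : Fin 3, (![(0 : K), 105, -65 / 4] i) * (![(117 : K), 1617, -91 / 4 + 949 / 8 * (ζ : K)] i) -
      ((3 : ℤ) : K) * (![(0 : K), 105, -65 / 4] i) ^ 2 +
      ((3 : ℤ) : K) ^ 2 * (![(117 : K), 1617, -91 / 4 + 949 / 8 * (ζ : K)] i) =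
      ((![(1053 : 𝓞 K), (151263 : 𝓞 K), (-20072 : 𝓞 K) - 27521 * ζ] i : 𝓞 K) : K) /
        ((![(1 : 𝓞 K), (1 : 𝓞 K), (32 : 𝓞 K)] i : 𝓞 K) : K) := by
    intro i
    fin_cases i
    · simp only [Fin.zero_eta, Matrix.cons_val_zero]
      simp only [map_ofNat, map_one]; push_cast; ring
    · simp only [Fin.mk_one, Matrix.cons_val_one, Matrix.cons_val_zero]
      simp only [map_ofNat, map_one]; push_cast; ring
    · simp only [Fin.reduceFinMk, Matrix.cons_val]
      simp only [NumberField.RingOfIntegers.coe_eq_algebraMap, map_sub, map_mul, map_neg, map_ofNat]; push_cast; ring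
  have hfb : (39 : K) * 507 - ((3 : ℤ) : K) * 39 ^ 2 + ((3 : ℤ) : K) ^ 2 * 507 =
      (((19773 : 𝓞 K) : 𝓞 K) : K) := by
    simp only [map_ofNat]; push_cast; norm_num
  -- the denominators are units at the three places
  have hden : ∀ i j : Fin 3, WithZero.log ((![v₀, v₁, v₂] j).valuation K
      ((![(1 : 𝓞 K), (1 : 𝓞 K), (32 : 𝓞 K)] i : 𝓞 K) : K)) = 0 := by
    intro i j
    fin_cases i
    · simp
    · simp
    · simpa using log_valuation_thirtytwo hζ hv₀ hv₁ hv₂ j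
  have hden0 : ∀ i j : Fin 3, (![v₀, v₁, v₂] j).valuation K
      ((![(1 : 𝓞 K), (1 : 𝓞 K), (32 : 𝓞 K)] i : 𝓞 K) : K) ≠ 0 := by
    intro i j
    rw [Valuation.ne_zero_iff]
    fin_cases i <;> simp
  have hnum0 : ∀ i j : Fin 3, (![v₀, v₁, v₂] j).valuation K
      ((![(1053 : 𝓞 K), (151263 : 𝓞 K), (-20072 : 𝓞 K) - 27521 * ζ] i : 𝓞 K) : K) ≠ 0 := by
    intro i j h0
    -- a zero numerator would have `log v₁ = 0`, but the table says `-1`, `0`, `-1`… use place `v₀`/`v₁` entries ≠ 0? No: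
    -- simpler: the element itself is nonzero iff its valuation is nonzero; read the table at a column where the order is nonzero
    have hz : (((![(1053 : 𝓞 K), (151263 : 𝓞 K), (-20072 : 𝓞 K) - 27521 * ζ] i : 𝓞 K) : K)) = 0 :=
      (Valuation.zero_iff _).mp h0
    fin_cases i
    · have h := log_valuation_points hζ hv₀ hv₁ hv₂ 0 0
      simp only [Fin.zero_eta, Matrix.cons_val_zero] at hz h
      rw [hz, map_zero, WithZero.log_zero] at h
      norm_num at h
    · have h := log_valuation_points hζ hv₀ hv₁ hv₂ 1 0
      simp only [Fin.mk_one, Matrix.cons_val_one, Matrix.cons_val_zero] at hz h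
      rw [hz, map_zero, WithZero.log_zero] at h
      norm_num at h
    · have h := log_valuation_points hζ hv₀ hv₁ hv₂ 2 1
      simp only [Fin.reduceFinMk, Matrix.cons_val, Matrix.cons_val_one, Matrix.cons_val_zero] at hz h
      rw [hz, map_zero, WithZero.log_zero] at h
      norm_num at h
  -- the matrix and its inverse mod 5
  have hmat : Matrix.of (fun i j : Fin 3 ↦
      ((WithZero.log ((![v₀, v₁, v₂] j).valuation K
          ((![(0 : K), 105, -65 / 4] i) * (![(117 : K), 1617, -91 / 4 + 949 / 8 * (ζ : K)] i) -
            ((3 : ℤ) : K) * (![(0 : K), 105, -65 / 4] i) ^ 2 +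
            ((3 : ℤ) : K) ^ 2 * (![(117 : K), 1617, -91 / 4 + 949 / 8 * (ζ : K)] i))) -
        WithZero.log ((![v₀, v₁, v₂] j).valuation K
          ((39 : K) * 507 - ((3 : ℤ) : K) * 39 ^ 2 + ((3 : ℤ) : K) ^ 2 * 507)) : ℤ) : ZMod 5)) =
      !![3, 2, 2; 0, 3, 3; 2, 2, 4] := by
    ext i j
    simp only [Matrix.of_apply]
    rw [hf i, hfb, map_div₀, WithZero.log_div (hnum0 i j) (hden0 i j), hden i j,
      log_valuation_points hζ hv₀ hv₁ hv₂ i j, log_valuation_base hζ hv₀ hv₁ hv₂ j]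
    fin_cases i <;> fin_cases j <;> decide
  have hinv : (!![2, 2, 0; 2, 1, 2; 3, 1, 3] : Matrix (Fin 3) (Fin 3) (ZMod 5)) * !![3, 2, 2; 0, 3, 3; 2, 2, 4] = 1 := by
    decide
  have hM : ∀ e : Fin 3 → ZMod 5, ∃ c : Fin 3 → ZMod 5, Matrix.vecMul c (Matrix.of (fun i j : Fin 3 ↦
      ((WithZero.log ((![v₀, v₁, v₂] j).valuation K
          ((![(0 : K), 105, -65 / 4] i) * (![(117 : K), 1617, -91 / 4 + 949 / 8 * (ζ : K)] i) -
            ((3 : ℤ) : K) * (![(0 : K), 105, -65 / 4] i) ^ 2 +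
            ((3 : ℤ) : K) ^ 2 * (![(117 : K), 1617, -91 / 4 + 949 / 8 * (ζ : K)] i))) -
        WithZero.log ((![v₀, v₁, v₂] j).valuation K
          ((39 : K) * 507 - ((3 : ℤ) : K) * 39 ^ 2 + ((3 : ℤ) : K) ^ 2 * 507)) : ℤ) : ZMod 5))) = e := by
    intro e
    refine ⟨Matrix.vecMul e !![2, 2, 0; 2, 1, 2; 3, 1, 3], ?_⟩
    rw [hmat, Matrix.vecMul_vecMul, hinv, Matrix.vecMul_one]
  -- the reference point `P₁ = (105, 1617)`, `25 P₁ ≠ O` transported from `ℚ` (good prime `2`)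
  have h25 := KubertTateGaussianTwist.twentyfive_zsmul_toGeomPoints_cast_ne_zero (K := K) 13 3 nonsingular_P₁_rat
    (by norm_num) (by norm_num) 2 (by norm_num) (by norm_num) KubertTate133Descent.not_tor_dvd_Δ
  refine ⟨?_, ?_, ?_⟩
  · exact KubertTateMuDescentNF.shaCorank_five_eq_zero_of_matrix 13 3 _ (fun σ ↦ smul_toGeomPoints _ σ _) h25
      KubertTate133Descent.not_five_dvd_Δ KubertTate133Descent.gaussian_tame ![v₀, v₁, v₂] hpl hS
      ![(0 : K), 105, -65 / 4] ![(117 : K), 1617, -91 / 4 + 949 / 8 * (ζ : K)]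
      (fun i ↦ by fin_cases i <;> assumption) (fun i ↦ by fin_cases i <;> norm_num)
      39 507 hnb (by norm_num) hM
  · exact KubertTateMuDescentNF.sha_torsionBy_five_eq_bot_of_matrix 13 3 _ (fun σ ↦ smul_toGeomPoints _ σ _) h25
      KubertTate133Descent.not_five_dvd_Δ KubertTate133Descent.gaussian_tame ![v₀, v₁, v₂] hpl hS
      ![(0 : K), 105, -65 / 4] ![(117 : K), 1617, -91 / 4 + 949 / 8 * (ζ : K)]
      (fun i ↦ by fin_cases i <;> assumption) (fun i ↦ by fin_cases i <;> norm_num)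
      39 507 hnb (by norm_num) hM
  · exact KubertTateMuDescentNF.mordellWeilRank_succ_eq_of_matrix 13 3 _ (fun σ ↦ smul_toGeomPoints _ σ _) h25
      KubertTate133Descent.not_five_dvd_Δ KubertTate133Descent.gaussian_tame ![v₀, v₁, v₂] hpl hS
      ![(0 : K), 105, -65 / 4] ![(117 : K), 1617, -91 / 4 + 949 / 8 * (ζ : K)]
      (fun i ↦ by fin_cases i <;> assumption) (fun i ↦ by fin_cases i <;> norm_num)
      39 507 hnb (by norm_num) hM

/-! ## §4 The theorems -/

/-- **`t₅(E_{13/3} ⊗ ℚ(i)) = 0`, UNCONDITIONALLY**, by the complete `5`-descent over `ℚ(i)` at three places.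
[cite: SilvermanAEC2009, Thm. X.4.2(a)] [cite: Fisher2001FiveSevenDescent, §2] -/
theorem shaCorank_five_eq_zero :
    haveI := isElliptic (K := K)
    (kubertTateFive ((13 : ℤ) : K) ((3 : ℤ) : K)).shaCorank 5 = 0 := (descent (K := K)).1

/-- **`Ш(E_{13/3}/ℚ(i))[5] = 0`, unconditionally.** [cite: SilvermanAEC2009, Thm. X.4.2(a)] -/
theorem sha_torsionBy_five_eq_bot :
    haveI := isElliptic (K := K)
    (kubertTateFive ((13 : ℤ) : K) ((3 : ℤ) : K)).sha[((5 : ℕ) : ℤ)] = ⊥ := (descent (K := K)).2.1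

/-- **`rank E_{13/3}(ℚ(i)) = 2`, unconditionally** (box of three places full, `#E(ℚ(i))[5] = 5`).
[cite: SilvermanAEC2009, Thm. X.4.2 and Thm. X.1.1] -/
theorem mordellWeilRank_eq_two :
    haveI := isElliptic (K := K)
    (kubertTateFive ((13 : ℤ) : K) ((3 : ℤ) : K)).mordellWeilRank = 2 := by
  have h := (descent (K := K)).2.2
  omega

/-- **`rank E_{13/3}^{(-4)}(ℚ) = 1`, unconditionally**: `rank E(ℚ(i)) = rank E(ℚ) + rank E^{(-4)}(ℚ)` with `2 = 1 + ·`.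
[cite: SilvermanAEC2009, Exercise 10.16] -/
theorem mordellWeilRank_twist_eq_one (K : Type) [Field K] [NumberField K] [IsCyclotomicExtension {4} ℚ K] :
    haveI := KubertTate133Descent.isElliptic
    ∀ [((kubertTateFive (((13 : ℤ) : ℚ)) (((3 : ℤ) : ℚ))).quadraticTwist (-4)).IsElliptic],
      ((kubertTateFive (((13 : ℤ) : ℚ)) (((3 : ℤ) : ℚ))).quadraticTwist (-4)).mordellWeilRank = 1 := by
  haveI := KubertTate133Descent.isElliptic
  intro htw
  have hR := KubertTateGaussianTwist.mordellWeilRank_base_eq_add (K := K) 13 3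
  have h2 := mordellWeilRank_eq_two (K := K)
  have h1 := KubertTate133Descent.mordellWeilRank_eq
  omega

/-- Transport of `t_p` along an equality of curves. [folklore] -/
private theorem shaCorank_congr {F : Type} [Field F] [NumberField F] {V V' : WeierstrassCurve F}
    [V.IsElliptic] [V'.IsElliptic] (e : V = V') (p : ℕ) [Fact p.Prime] : V.shaCorank p = V'.shaCorank p := by
  subst e; rfl

/-- `[ℚ(ζ₄) : ℚ] = 2`. [folklore] -/
private theorem finrank_rat_four : Module.finrank ℚ K = 2 := by
  rw [IsCyclotomicExtension.finrank (n := 4) K (Polynomial.cyclotomic.irreducible_rat (by norm_num)),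
    show Nat.totient 4 = 2 by decide]

/-- **`t₅(E_{13/3}^{(-4)}/ℚ) = 0`, unconditionally** — the door at `5` on a RANK-`1` twist WITHOUT a rational `5`-torsion point,
by descent alone (`t₅(E_K) = t₅(E) + t₅(E^{(d_K)})` with `t₅(E_K) = 0`; no `L`-value, no Gross–Zagier–Kolyvagin).
[cite: Dokchitser2013ParityNotes, §4] [cite: SilvermanAEC2009, Thm. X.4.2] -/
theorem shaCorank_five_twist_eq_zero (K : Type) [Field K] [NumberField K] [IsCyclotomicExtension {4} ℚ K] :
    haveI := KubertTate133Descent.isElliptic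
    ∀ [((kubertTateFive (((13 : ℤ) : ℚ)) (((3 : ℤ) : ℚ))).quadraticTwist (-4)).IsElliptic],
      ((kubertTateFive (((13 : ℤ) : ℚ)) (((3 : ℤ) : ℚ))).quadraticTwist (-4)).shaCorank 5 = 0 := by
  haveI : Fact (Nat.Prime 5) := ⟨Nat.prime_five⟩
  haveI := isElliptic (K := K)
  haveI := KubertTate133Descent.isElliptic
  intro htw
  set W := kubertTateFive (((13 : ℤ) : ℚ)) (((3 : ℤ) : ℚ)) with hW
  haveI hbc : (W.baseChange K).IsElliptic := by
    rw [hW, KubertTateMuDescentNF.baseChange_eq (K := ℚ) 13 3 K]; exact isElliptic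
  have hd : ((NumberField.discr K : ℤ) : ℚ) ≠ 0 := by exact_mod_cast NumberField.discr_ne_zero K
  haveI : (W.quadraticTwist (NumberField.discr K : ℚ)).IsElliptic := isElliptic_quadraticTwist _ hd
  have hS := selmerCorank_baseChange_quadratic_holds W K finrank_rat_four 5
  have hR := mordellWeilRank_baseChange_quadratic_holds W K finrank_rat_four
  have hK := (W.baseChange K).selmerCorank_eq_mordellWeilRank_add_holds 5
  have hQ := W.selmerCorank_eq_mordellWeilRank_add_holds 5
  have hT := (W.quadraticTwist (NumberField.discr K : ℚ)).selmerCorank_eq_mordellWeilRank_add_holds 5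
  have h0 : (W.baseChange K).shaCorank 5 = 0 := by
    rw [shaCorank_congr (KubertTateMuDescentNF.baseChange_eq (K := ℚ) 13 3 K) 5]
    exact shaCorank_five_eq_zero (K := K)
  have h4 : ((NumberField.discr K : ℤ) : ℚ) = -4 := by rw [discr_of_isCyclotomicExtension_four K]; norm_num
  rw [h4] at hS hR hT
  omega

/-- **Both, over the concrete carrier `CyclotomicField 4 ℚ`**: `rank E_{13/3}^{(-4)}(ℚ) = 1` and `t₅(E_{13/3}^{(-4)}/ℚ) = 0`,
together with `t₅(E_{13/3}/ℚ) = 0`. [cite: SilvermanAEC2009, Thm. X.4.2 and Exercise 10.16] -/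
theorem twist_13_3 :
    haveI := KubertTate133Descent.isElliptic
    ∀ [((kubertTateFive (((13 : ℤ) : ℚ)) (((3 : ℤ) : ℚ))).quadraticTwist (-4)).IsElliptic],
      ((kubertTateFive (((13 : ℤ) : ℚ)) (((3 : ℤ) : ℚ))).quadraticTwist (-4)).mordellWeilRank = 1 ∧
        ((kubertTateFive (((13 : ℤ) : ℚ)) (((3 : ℤ) : ℚ))).quadraticTwist (-4)).shaCorank 5 = 0 ∧
        (kubertTateFive (((13 : ℤ) : ℚ)) (((3 : ℤ) : ℚ))).shaCorank 5 = 0 := by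
  intro htw
  haveI : IsCyclotomicExtension {4} ℚ (CyclotomicField 4 ℚ) := CyclotomicField.isCyclotomicExtension 4 ℚ
  exact ⟨mordellWeilRank_twist_eq_one (CyclotomicField 4 ℚ), shaCorank_five_twist_eq_zero (CyclotomicField 4 ℚ),
    KubertTate133Descent.shaCorank_five_eq_zero⟩

end KubertTate133GaussianDescent

end Literature.NumberTheory.EllipticCurves

end
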